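import Mathlib
import Summits.Parity.BatemanHorn.Theses.IsogenyRedei

/-!
# Sketch — crux-ideate stmt-Parity-15002 (SplitBlockJacobiCorner), ideator 1, round 1

First lemmas of the two idea cards (statements only need to elaborate; proofs are for the line).

* Card `theta-spin-level-average`: `PairSymbolImProducts` (the Jacobi symbol of the prime pair is the
  symbol of the product of the imaginary parts of the two Gaussian integers of norm `QQ'`; with FI's
  `jacobiSym_kubota` this is `(Q|Q') = η [wz][w z̄]`), and `spinKernel_sl2` (the root position
  `t/n = c/d + b/(dn)` for the `SL₂(ℤ)` matrix of the factorisation `t + i = conj(w_m) · z₁`).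
* Card `salie-normal-form-shear`: `NormalFormExact` — the exact integer form of
  `ν*/(Qn) ≡ (ν_w − r s⁻¹) n⁻¹ / Q − (Qr)⁻¹ / s + r/(Qsn) (mod 1)`.
-/

namespace Summit.Parity.BatemanHorn.Cruxes.SplitBlockJacobiCorner.Sketch

/-- Card A, first lemma (rational form of the two-spin factorisation): for `Q = u² + v²`,
`Q' = r² + s²` with `(v, Q) = 1`, `(Q'|Q) = ((us + vr)(vr − us) | Q)`; here `us + vr = Im(wz)` and
`vr − us = Im(w z̄)` for `w = u + iv`, `z = r + is`. (Proof: `(us+vr)(vr−us) = v²r² − u²s² ≡ v² Q'`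
modulo `Q` since `u² ≡ −v²`.) -/
def PairSymbolImProducts : Prop :=
  ∀ (Q : ℕ) (Q' u v r s : ℤ), (Q : ℤ) = u ^ 2 + v ^ 2 → Q' = r ^ 2 + s ^ 2 → Int.gcd v Q = 1 →
    jacobiSym Q' Q = jacobiSym ((u * s + v * r) * (v * r - u * s)) Q

/-- Card A, second lemma (the `SL₂(ℤ)` root position, a ring identity): for `a d − b c = 1`, with
`n = b² + d²`, `t = a b + c d` one has `t d − c n = b`, i.e. `t/n = c/d + b/(d n)`: the root phase
`e(h t/n)` is the Kloosterman phase `e(h c/d)` of the matrix up to `1 + O(h/n)`. -/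
theorem spinKernel_sl2 (a b c d : ℤ) (h : a * d - b * c = 1) :
    (a * b + c * d) * d - c * (b ^ 2 + d ^ 2) = b := by
  linear_combination b * h

/-- Card B, first lemma (exact normal form behind
`(Q|Q') e(hν*/QQ') = χ_Q(r²+s²) · e_Q(−h · inv[s(r+ν_w s)]) · e_s(−h · inv[Q r]) · (1 + O(h/(Qs)))`):
with `n = r² + s²`, `a ≡ s⁻¹`, `b ≡ n⁻¹ (mod Q)`, `c ≡ (Qr)⁻¹ (mod s)`, `ρ ≡ −r⁻¹ (mod s)`,
`ν = (nρ + r)/s` (an integer root of `−1 (mod n)`) and `ν*` the CRT lift of `(ν_w mod Q, ν mod n)`,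
`Q s n ∣ ν* s − ((ν_w − r a) b s n − c Q n + r)`. Checked numerically (exp/check_normal_form_exact.py,
1827/1827 random instances incl. shifted representatives); no hypothesis `ν_w² ≡ −1` is needed. -/
def NormalFormExact : Prop :=
  ∀ (Q s n r νw ν νs ρ a b c : ℤ), n = r ^ 2 + s ^ 2 → s ∣ r * ρ + 1 → ν * s = n * ρ + r →
    Q ∣ a * s - 1 → Q ∣ b * n - 1 → s ∣ c * (Q * r) - 1 → Q ∣ νs - νw → n ∣ νs - ν →
    Q * s * n ∣ νs * s - ((νw - r * a) * b * s * n - c * Q * n + r)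

/-- The crux, by name, for orientation (no claim made here). -/
example : Prop := Summit.Parity.BatemanHorn.Theses.IsogenyRedei.SplitBlockJacobiCorner

end Summit.Parity.BatemanHorn.Cruxes.SplitBlockJacobiCorner.Sketch
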